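import Summits.CriticalPhenomena.PercolationContinuityZ3.Theorems.PercNearOneGluingNoHeavyLowerTailCSHPsiWorld
import Summits.CriticalPhenomena.PercolationContinuityZ3.Theorems.PercNearOneGluingNoHeavyLowerTailCSHPsiSetFourPT
import Summits.CriticalPhenomena.PercolationContinuityZ3.Theorems.PercNearOneGluingAdditiveGluingCSHHtwBridge
import HarnessLib

/-!
# Pinned hierarchy (PIN-CSH) — (Htw)_ψ in world form and LEMMA H_ψ (the H-part of the unfolding is nonnegative), unconditionally

Support file (`--supports stmt-CriticalPhenomena-4575`), route task `nh-dp-fatminority` (line fat-minority-linear, gen 16); memo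
`run/shared/lean/prim/prim-nh-dp-fatminority/CSH-PSI-MEMO.md` §2 ((K6)_ψ, (K9)_ψ/(Htw)_ψ, Lemma H_ψ).  Third brick of the Lean proof of
memo THEOREM 1_ψ (`PinCSH.Holds`).  No definitions, no named facts, no sorries.

This is the pinned twin of prim-png-lead-4576's `…AdditiveGluingCSHHtwBridge.lean` / `…AdditiveGluingCSHHpart.lean`: the observer's vertex
test `1{o ∈ C_v}` is replaced by the PINNED test `ψ(C_v) = 1{o ∈ C_v}·1{C_v ∈ 𝓗}` (`PinCSH.pinEv o 𝓗 v`, `𝓗` an upper family of edge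
sets), read on the open edge cluster as the monotone `[0,1]`-valued functional `C ↦ 1{(o = v ∨ o ∈ V(C)) ∧ C ∈ 𝓗}` which is fed to the
general-`θ` two-source induction `CovTau.p1G_univ` (`…CSHPsiWorld.lean`).

* `pinInd_openEdgeCluster`, `pinInd_mono` — the pinned functional read on the edge cluster is `1_{pinEv o 𝓗 v}`; it is monotone;
* `EavG_univ_eq_pin`, `qG_rest_univ_pin` — dictionary: `E^ψ_S(Y) = μ(v ↮ S ∪ Y, pinEv o 𝓗 v)` on the whole graph, and the world constant
  `q^ψ_S(G ∖ C_Y(ω)) = μ_{w^ω}(v ↮ S, pinEv o 𝓗 v)/μ_{w^ω}(v ↮ S)` (`w^ω` = `w` zeroed on the pairs meeting the open vertex cluster of `Y`);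
* `htw_world_pin` — (Htw)_ψ in world form: `μ(v↮S∪Y, pinEv o 𝓗 v)·∫_{x↮Y} Cov_{w^ω}(g(C_x),1{v↔S}) ≤ μ(v↮S∪Y)·∫_{x↮Y} p^ψ_ω·Cov_{w^ω}(g(C_x),1{v↔S})`;
* `hpart_nonneg_of_htw_pin`, `hpart_nonneg_pin` — LEMMA H_ψ: for non-degenerate `w`, `x ∈ S`, `v ∉ S ∪ Y`, `g` monotone `≥ 0`,
  `0 ≤ ∫_{x↮Y} [Cov_{w^ω}(g(C_x), 1{o ↔ S}·1{C_o ∈ 𝓗}) − p_ψ·Cov_{w^ω}(g(C_x), 1{v ↔ S})] dμ_w(ω)`, `p_ψ = μ(pinEv o 𝓗 v | v ↮ S ∪ Y)`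
  (`PinCSH.pObsConst`): (K6)_ψ world by world (`PinCSH.setFourPT_pin`, gen 15) plus (Htw)_ψ.
[cite: VandenbergHaggstromKahn2005, Thm. 1.1 (pp. 3–5), Thm. 1.4 (p. 7), Thm. 1.5 (p. 7), §2.1 Lemmas 2.3–2.4 (p. 10)] [cite: Gladkov2024, Thm. 3.2 (p. 4)]
[cite: KozmaNitzan2024, Conj. 4 (p. 32), Question 7 (p. 36)]
-/

noncomputable section

namespace Summit.CriticalPhenomena.PercolationContinuityZ3.Theorems

open MeasureTheory Set
open Literature.Probability.LatticeModels (prodBernoulli prodBernoulli_real_pos_of_nonempty)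
open Literature.Probability.Percolation Literature.Probability.Percolation.KNPreFKG
open Literature.Probability.Percolation.BHK2006 (weight edgesIn rC rD ind_inter weight_nonneg ind_le_one)
open DecisionTree (ind ind_of_mem ind_of_not_mem ind_nonneg)
open CovTau
open scoped Classical

namespace PinCSH

variable {V : Type*} [Fintype V]

/-! ### The pinned test as a functional of the edge cluster -/

omit [Fintype V] in
/-- **The pinned functional read on the edge cluster is `1_{pinEv o 𝓗 v}`**: `1{(o = v ∨ o ∈ V(C_v)) ∧ C_v ∈ 𝓗} = 1{v ↔ o}·1{C_v ∈ 𝓗}`.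
[folklore] -/
theorem pinInd_openEdgeCluster (o : V) (𝓗 : Set (Set (Sym2 V))) (v : V) (ζ : Set (Sym2 V)) :
    ind {C : Set (Sym2 V) | (o = v ∨ ∃ e ∈ C, o ∈ e) ∧ C ∈ 𝓗} (openEdgeCluster ζ v) = ind (pinEv o 𝓗 v) ζ := by
  by_cases h : ζ ∈ pinEv o 𝓗 v
  · rw [ind_of_mem h, ind_of_mem (show openEdgeCluster ζ v ∈ {C : Set (Sym2 V) | (o = v ∨ ∃ e ∈ C, o ∈ e) ∧ C ∈ 𝓗} from
      ⟨(reachable_iff_exists_mem_openEdgeCluster ζ v o).1 h.1, h.2⟩)]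
  · rw [ind_of_not_mem h, ind_of_not_mem (show openEdgeCluster ζ v ∉ {C : Set (Sym2 V) | (o = v ∨ ∃ e ∈ C, o ∈ e) ∧ C ∈ 𝓗} from
      fun h' => h ⟨(reachable_iff_exists_mem_openEdgeCluster ζ v o).2 h'.1, h'.2⟩)]

omit [Fintype V] in
/-- The pinned functional is monotone in the edge set (for an upper family `𝓗`). [folklore] -/
theorem pinInd_mono (o : V) {𝓗 : Set (Set (Sym2 V))} (h𝓗 : IsUpperSet 𝓗) (v : V) :
    Monotone (fun C : Set (Sym2 V) => ind {C : Set (Sym2 V) | (o = v ∨ ∃ e ∈ C, o ∈ e) ∧ C ∈ 𝓗} C) := by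
  intro C C' hCC'
  by_cases hC : C ∈ {C : Set (Sym2 V) | (o = v ∨ ∃ e ∈ C, o ∈ e) ∧ C ∈ 𝓗}
  · have hC' : C' ∈ {C : Set (Sym2 V) | (o = v ∨ ∃ e ∈ C, o ∈ e) ∧ C ∈ 𝓗} := by
      refine ⟨?_, h𝓗 hCC' hC.2⟩
      rcases hC.1 with h1 | ⟨e, he, hoe⟩
      · exact Or.inl h1
      · exact Or.inr ⟨e, hCC' he, hoe⟩
    simp only [ind_of_mem hC, ind_of_mem hC', le_refl]
  · simp only [ind_of_not_mem hC]
    exact ind_nonneg _ _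

omit [Fintype V] in
/-- `{v ↮ S}` does not depend on the direction in which reachability is read. [folklore] -/
theorem setOf_forall_not_reachable_comm (S : Finset V) (v : V) :
    {η : Set (Sym2 V) | ∀ s ∈ (↑S : Set V), ¬ (openGraph η).Reachable s v} =
      {η : BondConfig V | ∀ t ∈ S, ¬ (openGraph η).Reachable v t} := by
  ext η
  simp only [mem_setOf_eq, Finset.mem_coe]
  exact forall₂_congr fun s _ => by rw [SimpleGraph.reachable_comm]

/-! ### Dictionary for the pinned observer functional -/

/-- `E^ψ_S(Y) = μ(v ↮ S ∪ Y, pinEv o 𝓗 v)` in `G = G[univ]`. [cite: VandenbergHaggstromKahn2005, §1 p. 3] -/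
theorem EavG_univ_eq_pin (p : Sym2 V → unitInterval) (o : V) (𝓗 : Set (Set (Sym2 V))) (v : V) (S : Finset V) (Y : Set V) :
    EavG (fun e => (p e : ℝ)) Finset.univ (↑S : Set V)
        (fun C : Set (Sym2 V) => ind {C : Set (Sym2 V) | (o = v ∨ ∃ e ∈ C, o ∈ e) ∧ C ∈ 𝓗} C) v Y =
      (prodBernoulli p).real ({ω : BondConfig V | ∀ a ∈ (↑S ∪ Y : Set V), ¬ (openGraph ω).Reachable v a} ∩ pinEv o 𝓗 v) := by
  rw [EavG, ← sum_weight_ind]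
  refine Finset.sum_congr rfl fun ω _ => ?_
  congr 1
  rw [rC_univ, rD_univ, pinInd_openEdgeCluster, ← ind_inter, inter_comm]

/-- **`q^ψ_S` in the world `G ∖ C_Y(ω)`** = `μ_{p^ω}(v ↮ S, pinEv o 𝓗 v) / μ_{p^ω}(v ↮ S)`, `p^ω` = `p` zeroed on the pairs meeting the
open vertex cluster of `Y`. [cite: VandenbergHaggstromKahn2005, §2.1 Lemmas 2.3–2.4 (p. 10)] -/
theorem qG_rest_univ_pin (p : Sym2 V → unitInterval) (o : V) (𝓗 : Set (Set (Sym2 V))) (v : V) (S : Finset V) (Y : Set V)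
    (ω : Set (Sym2 V)) :
    EavG (fun e => (p e : ℝ)) (rest Finset.univ Y ω) (↑S : Set V)
          (fun C : Set (Sym2 V) => ind {C : Set (Sym2 V) | (o = v ∨ ∃ e ∈ C, o ∈ e) ∧ C ∈ 𝓗} C) v ∅ /
        Mav (fun e => (p e : ℝ)) (rest Finset.univ Y ω) (↑S : Set V) v ∅ =
      (prodBernoulli fun e => if (∃ z ∈ e, ∃ y ∈ Y, (openGraph ω).Reachable y z) then (0 : unitInterval) else p e).real
          ({η : BondConfig V | ∀ t ∈ S, ¬ (openGraph η).Reachable v t} ∩ pinEv o 𝓗 v) /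
        (prodBernoulli fun e => if (∃ z ∈ e, ∃ y ∈ Y, (openGraph ω).Reachable y z) then (0 : unitInterval) else p e).real
          {η : BondConfig V | ∀ t ∈ S, ¬ (openGraph η).Reachable v t} := by
  set pw : Sym2 V → unitInterval := fun e => if (∃ z ∈ e, ∃ y ∈ Y, (openGraph ω).Reachable y z) then (0 : unitInterval) else p e
    with hpw
  have hset : {ζ : Set (Sym2 V) | ∀ z ∈ (↑S : Set V) ∪ (∅ : Set V), ¬ (openGraph ζ).Reachable v z} =
      {η : BondConfig V | ∀ t ∈ S, ¬ (openGraph η).Reachable v t} := by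
    ext ζ; simp only [union_empty, mem_setOf_eq, Finset.mem_coe]
  have h1 : EavG (fun e => (p e : ℝ)) (rest Finset.univ Y ω) (↑S : Set V)
      (fun C : Set (Sym2 V) => ind {C : Set (Sym2 V) | (o = v ∨ ∃ e ∈ C, o ∈ e) ∧ C ∈ 𝓗} C) v ∅ =
      ∫ η, ind ({η : BondConfig V | ∀ t ∈ S, ¬ (openGraph η).Reachable v t} ∩ pinEv o 𝓗 v) η ∂(prodBernoulli pw) := by
    have h := CSH.sum_weight_rest_univ_set p Y ω (fun ζ =>
      ind {C : Set (Sym2 V) | (o = v ∨ ∃ e ∈ C, o ∈ e) ∧ C ∈ 𝓗} (openEdgeCluster ζ v) *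
        ind {ζ : Set (Sym2 V) | ∀ z ∈ (↑S : Set V) ∪ (∅ : Set V), ¬ (openGraph ζ).Reachable v z} ζ)
    refine (Eq.trans (by rfl) h).trans ?_
    congr 1
    funext η
    rw [pinInd_openEdgeCluster, ← ind_inter, inter_comm, hset]
  have h2 : Mav (fun e => (p e : ℝ)) (rest Finset.univ Y ω) (↑S : Set V) v ∅ =
      ∫ η, ind {η : BondConfig V | ∀ t ∈ S, ¬ (openGraph η).Reachable v t} η ∂(prodBernoulli pw) := by
    have h := CSH.sum_weight_rest_univ_set p Y ω (fun ζ =>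
      ind {ζ : Set (Sym2 V) | ∀ z ∈ (↑S : Set V) ∪ (∅ : Set V), ¬ (openGraph ζ).Reachable v z} ζ)
    refine (Eq.trans (by rfl) h).trans ?_
    rw [hset]
  rw [h1, h2, ind_eq_indicator_one, ind_eq_indicator_one, integral_indicator_one MeasurableSet.of_discrete,
    integral_indicator_one MeasurableSet.of_discrete]

/-! ### (Htw)_ψ in world form -/

/-- **(Htw)_ψ in world form, UNCONDITIONAL** (from `CovTau.p1G_univ` with the pinned functional): for `x ∈ S`, `v ∉ S`, `g` monotone
`≥ 0`, `𝓗` upper, every `Y`,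
`μ(v↮S∪Y, pinEv o 𝓗 v)·∫_{x↮Y} Cov_{w^ω}(g(C_x),1{v↔S}) dμ ≤ μ(v↮S∪Y)·∫_{x↮Y} p^ψ_ω·Cov_{w^ω}(g(C_x),1{v↔S}) dμ`,
`p^ψ_ω = μ_{w^ω}(pinEv o 𝓗 v | v↮S)`. (transcription of the memo prim-nh-dp-fatminority CSH-PSI-MEMO.md §2 (Htw)_ψ)
[cite: VandenbergHaggstromKahn2005, Thm. 1.1 (pp. 3–5), Thm. 1.4 (p. 7)] [cite: Gladkov2024, Thm. 3.2 (p. 4)] -/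
theorem htw_world_pin (w : Sym2 V → unitInterval) (x : V) (Y : Set V) (S : Finset V) (hxS : x ∈ S) (o : V)
    (𝓗 : Set (Set (Sym2 V))) (h𝓗 : IsUpperSet 𝓗) (v : V) (hvS : v ∉ S)
    (g : Set (Sym2 V) → ℝ) (hg : Monotone g) (hg0 : ∀ C, 0 ≤ g C) :
    (prodBernoulli w).real ({ω : BondConfig V | ∀ a ∈ (↑S ∪ Y : Set V), ¬ (openGraph ω).Reachable v a} ∩ pinEv o 𝓗 v) *
        (∫ ω in {ω : BondConfig V | ∀ y ∈ Y, ¬ (openGraph ω).Reachable x y},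
          ((∫ η in (⋃ t ∈ S, openConn v t), g (openEdgeCluster η x)
              ∂(prodBernoulli fun e => if (∃ z ∈ e, ∃ y ∈ Y, (openGraph ω).Reachable y z) then (0 : unitInterval) else w e)) -
            (prodBernoulli fun e => if (∃ z ∈ e, ∃ y ∈ Y, (openGraph ω).Reachable y z) then (0 : unitInterval) else w e).real
                (⋃ t ∈ S, openConn v t) *
              (∫ η, g (openEdgeCluster η x)
                ∂(prodBernoulli fun e => if (∃ z ∈ e, ∃ y ∈ Y, (openGraph ω).Reachable y z) then (0 : unitInterval) else w e)))
          ∂(prodBernoulli w)) ≤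
      (prodBernoulli w).real {ω : BondConfig V | ∀ a ∈ (↑S ∪ Y : Set V), ¬ (openGraph ω).Reachable v a} *
        (∫ ω in {ω : BondConfig V | ∀ y ∈ Y, ¬ (openGraph ω).Reachable x y},
          ((prodBernoulli fun e => if (∃ z ∈ e, ∃ y ∈ Y, (openGraph ω).Reachable y z) then (0 : unitInterval) else w e).real
                ({η : BondConfig V | ∀ t ∈ S, ¬ (openGraph η).Reachable v t} ∩ pinEv o 𝓗 v) /
              (prodBernoulli fun e => if (∃ z ∈ e, ∃ y ∈ Y, (openGraph ω).Reachable y z) then (0 : unitInterval) else w e).real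
                {η : BondConfig V | ∀ t ∈ S, ¬ (openGraph η).Reachable v t}) *
          ((∫ η in (⋃ t ∈ S, openConn v t), g (openEdgeCluster η x)
              ∂(prodBernoulli fun e => if (∃ z ∈ e, ∃ y ∈ Y, (openGraph ω).Reachable y z) then (0 : unitInterval) else w e)) -
            (prodBernoulli fun e => if (∃ z ∈ e, ∃ y ∈ Y, (openGraph ω).Reachable y z) then (0 : unitInterval) else w e).real
                (⋃ t ∈ S, openConn v t) *
              (∫ η, g (openEdgeCluster η x)
                ∂(prodBernoulli fun e => if (∃ z ∈ e, ∃ y ∈ Y, (openGraph ω).Reachable y z) then (0 : unitInterval) else w e)))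
          ∂(prodBernoulli w)) := by
  set w' : Sym2 V → ℝ := fun e => (w e : ℝ) with hw'
  have hw0 : ∀ e, 0 ≤ w' e := fun e => (w e).2.1
  have hw1 : ∀ e, w' e ≤ 1 := fun e => (w e).2.2
  have hm : ∑ ω, weight w' ω = 1 := sum_weight_coe_eq_one w
  set θ : Set (Sym2 V) → ℝ := fun C : Set (Sym2 V) => ind {C : Set (Sym2 V) | (o = v ∨ ∃ e ∈ C, o ∈ e) ∧ C ∈ 𝓗} C with hθ
  have key := p1G_univ w' hw0 hw1 hm (S := (↑S : Set V)) (Finset.mem_coe.2 hxS) (fun h => hvS (Finset.mem_coe.1 h))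
    (θ := θ) (pinInd_mono o h𝓗 v) (fun C => ind_nonneg _ C) (fun C => ind_le_one _ C) hg hg0 Y
  -- translate the four functionals
  have hE := EavG_univ_eq_pin w o 𝓗 v S Y
  have hM := CSH.Mav_univ_eq w v S Y
  have hY : Yw w' Finset.univ x (fun U' => BfS w' U' x (↑S : Set V) v g) Y =
      ∫ ω in {ω : BondConfig V | ∀ y ∈ Y, ¬ (openGraph ω).Reachable x y},
          ((∫ η in (⋃ t ∈ S, openConn v t), g (openEdgeCluster η x)
              ∂(prodBernoulli fun e => if (∃ z ∈ e, ∃ y ∈ Y, (openGraph ω).Reachable y z) then (0 : unitInterval) else w e)) -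
            (prodBernoulli fun e => if (∃ z ∈ e, ∃ y ∈ Y, (openGraph ω).Reachable y z) then (0 : unitInterval) else w e).real
                (⋃ t ∈ S, openConn v t) *
              (∫ η, g (openEdgeCluster η x)
                ∂(prodBernoulli fun e => if (∃ z ∈ e, ∃ y ∈ Y, (openGraph ω).Reachable y z) then (0 : unitInterval) else w e)))
          ∂(prodBernoulli w) := by
    rw [Yw]
    simp only [hw', CSH.BfS_rest_univ, rD_univ]
    exact sum_weight_mul_ind w _ _
  have hX : Yw w' Finset.univ x (fun U' => EavG w' U' (↑S : Set V) θ v ∅ / Mav w' U' (↑S : Set V) v ∅ *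
      BfS w' U' x (↑S : Set V) v g) Y =
      ∫ ω in {ω : BondConfig V | ∀ y ∈ Y, ¬ (openGraph ω).Reachable x y},
          ((prodBernoulli fun e => if (∃ z ∈ e, ∃ y ∈ Y, (openGraph ω).Reachable y z) then (0 : unitInterval) else w e).real
                ({η : BondConfig V | ∀ t ∈ S, ¬ (openGraph η).Reachable v t} ∩ pinEv o 𝓗 v) /
              (prodBernoulli fun e => if (∃ z ∈ e, ∃ y ∈ Y, (openGraph ω).Reachable y z) then (0 : unitInterval) else w e).real
                {η : BondConfig V | ∀ t ∈ S, ¬ (openGraph η).Reachable v t}) *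
          ((∫ η in (⋃ t ∈ S, openConn v t), g (openEdgeCluster η x)
              ∂(prodBernoulli fun e => if (∃ z ∈ e, ∃ y ∈ Y, (openGraph ω).Reachable y z) then (0 : unitInterval) else w e)) -
            (prodBernoulli fun e => if (∃ z ∈ e, ∃ y ∈ Y, (openGraph ω).Reachable y z) then (0 : unitInterval) else w e).real
                (⋃ t ∈ S, openConn v t) *
              (∫ η, g (openEdgeCluster η x)
                ∂(prodBernoulli fun e => if (∃ z ∈ e, ∃ y ∈ Y, (openGraph ω).Reachable y z) then (0 : unitInterval) else w e)))
          ∂(prodBernoulli w) := by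
    rw [Yw]
    simp only [hw', hθ, CSH.BfS_rest_univ, qG_rest_univ_pin, rD_univ]
    exact sum_weight_mul_ind w _ _
  rw [hE, hY, hM, hX] at key
  exact key

/-! ### Lemma H_ψ -/

/-- **LEMMA H_ψ given (Htw)_ψ** (memo §2, Lemma H_ψ): the pinned H-part of the world-wise unfolding is nonnegative, GIVEN the pinned
two-source diagonal inequality (Htw)_ψ (hypothesis `hHtw`).  Setting: non-degenerate weights, owner `x ∈ S`, label `o` with the upper
family `𝓗`, observer `v ∉ S`, `v ∉ Y`, worlds `w^ω` over `ω ∈ {x ↮ Y}`, `g` monotone `≥ 0`, `p_ψ = μ(pinEv o 𝓗 v | v ↮ S ∪ Y)`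
(`PinCSH.pObsConst`).  CLAIM: `0 ≤ ∫_{x↮Y} [Cov_{w^ω}(g(C_x), 1{o↔S}·1{C_o ∈ 𝓗}) − p_ψ·Cov_{w^ω}(g(C_x), 1{v↔S})] dμ_w`: (K6)_ψ in
each world (`PinCSH.setFourPT_pin` at the weights `w^ω`) gives `Cov_ω(g, 1{o↔S}1{C_o∈𝓗}) ≥ p^ψ_ω Cov_ω(g, 1{v↔S})`, and (Htw)_ψ trades
`p^ψ_ω` for the global `p_ψ`. (transcription of the memo prim-nh-dp-fatminority CSH-PSI-MEMO.md §2 Lemma H_ψ)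
[cite: VandenbergHaggstromKahn2005, Thm. 1.4 (p. 7), Thm. 1.5 (p. 7)] -/
theorem hpart_nonneg_of_htw_pin (w : Sym2 V → unitInterval) (hw : ∀ e, 0 < w e ∧ w e < 1) (x : V) (Y : Set V) (S : Finset V)
    (hxS : x ∈ S) (o : V) (𝓗 : Set (Set (Sym2 V))) (h𝓗 : IsUpperSet 𝓗) (v : V) (hvS : v ∉ S) (hvY : v ∉ Y)
    (g : Set (Sym2 V) → ℝ) (hg : Monotone g) (hg0 : ∀ C, 0 ≤ g C)
    (hHtw : (prodBernoulli w).real ({ω : BondConfig V | ∀ a ∈ (↑S ∪ Y : Set V), ¬ (openGraph ω).Reachable v a} ∩ pinEv o 𝓗 v) *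
        (∫ ω in {ω : BondConfig V | ∀ y ∈ Y, ¬ (openGraph ω).Reachable x y},
          ((∫ η in (⋃ t ∈ S, openConn v t), g (openEdgeCluster η x)
              ∂(prodBernoulli fun e => if (∃ z ∈ e, ∃ y ∈ Y, (openGraph ω).Reachable y z) then (0 : unitInterval) else w e)) -
            (prodBernoulli fun e => if (∃ z ∈ e, ∃ y ∈ Y, (openGraph ω).Reachable y z) then (0 : unitInterval) else w e).real
                (⋃ t ∈ S, openConn v t) *
              (∫ η, g (openEdgeCluster η x)
                ∂(prodBernoulli fun e => if (∃ z ∈ e, ∃ y ∈ Y, (openGraph ω).Reachable y z) then (0 : unitInterval) else w e)))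
          ∂(prodBernoulli w)) ≤
      (prodBernoulli w).real {ω : BondConfig V | ∀ a ∈ (↑S ∪ Y : Set V), ¬ (openGraph ω).Reachable v a} *
        (∫ ω in {ω : BondConfig V | ∀ y ∈ Y, ¬ (openGraph ω).Reachable x y},
          ((prodBernoulli fun e => if (∃ z ∈ e, ∃ y ∈ Y, (openGraph ω).Reachable y z) then (0 : unitInterval) else w e).real
                ({η : BondConfig V | ∀ t ∈ S, ¬ (openGraph η).Reachable v t} ∩ pinEv o 𝓗 v) /
              (prodBernoulli fun e => if (∃ z ∈ e, ∃ y ∈ Y, (openGraph ω).Reachable y z) then (0 : unitInterval) else w e).real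
                {η : BondConfig V | ∀ t ∈ S, ¬ (openGraph η).Reachable v t}) *
          ((∫ η in (⋃ t ∈ S, openConn v t), g (openEdgeCluster η x)
              ∂(prodBernoulli fun e => if (∃ z ∈ e, ∃ y ∈ Y, (openGraph ω).Reachable y z) then (0 : unitInterval) else w e)) -
            (prodBernoulli fun e => if (∃ z ∈ e, ∃ y ∈ Y, (openGraph ω).Reachable y z) then (0 : unitInterval) else w e).real
                (⋃ t ∈ S, openConn v t) *
              (∫ η, g (openEdgeCluster η x)
                ∂(prodBernoulli fun e => if (∃ z ∈ e, ∃ y ∈ Y, (openGraph ω).Reachable y z) then (0 : unitInterval) else w e)))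
          ∂(prodBernoulli w))) :
    0 ≤ ∫ ω in {ω : BondConfig V | ∀ y ∈ Y, ¬ (openGraph ω).Reachable x y},
      (((∫ η in (⋃ t ∈ S, openConn o t) ∩ {η | openEdgeCluster η o ∈ 𝓗}, g (openEdgeCluster η x)
            ∂(prodBernoulli fun e => if (∃ z ∈ e, ∃ y ∈ Y, (openGraph ω).Reachable y z) then (0 : unitInterval) else w e)) -
          (prodBernoulli fun e => if (∃ z ∈ e, ∃ y ∈ Y, (openGraph ω).Reachable y z) then (0 : unitInterval) else w e).real
              ((⋃ t ∈ S, openConn o t) ∩ {η | openEdgeCluster η o ∈ 𝓗}) *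
            (∫ η, g (openEdgeCluster η x)
              ∂(prodBernoulli fun e => if (∃ z ∈ e, ∃ y ∈ Y, (openGraph ω).Reachable y z) then (0 : unitInterval) else w e))) -
        pObsConst w o 𝓗 v (↑S ∪ Y) *
          ((∫ η in (⋃ t ∈ S, openConn v t), g (openEdgeCluster η x)
              ∂(prodBernoulli fun e => if (∃ z ∈ e, ∃ y ∈ Y, (openGraph ω).Reachable y z) then (0 : unitInterval) else w e)) -
            (prodBernoulli fun e => if (∃ z ∈ e, ∃ y ∈ Y, (openGraph ω).Reachable y z) then (0 : unitInterval) else w e).real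
                (⋃ t ∈ S, openConn v t) *
              (∫ η, g (openEdgeCluster η x)
                ∂(prodBernoulli fun e => if (∃ z ∈ e, ∃ y ∈ Y, (openGraph ω).Reachable y z) then (0 : unitInterval) else w e))))
      ∂(prodBernoulli w) := by
  set μ := prodBernoulli w with hμ
  -- world weights and world quantities
  set wW : BondConfig V → Sym2 V → unitInterval := fun ω e =>
    if (∃ z ∈ e, ∃ y ∈ Y, (openGraph ω).Reachable y z) then (0 : unitInterval) else w e with hwW
  set CovO : BondConfig V → ℝ := fun ω =>
    (∫ η in (⋃ t ∈ S, openConn o t) ∩ {η | openEdgeCluster η o ∈ 𝓗}, g (openEdgeCluster η x) ∂(prodBernoulli (wW ω))) -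
      (prodBernoulli (wW ω)).real ((⋃ t ∈ S, openConn o t) ∩ {η | openEdgeCluster η o ∈ 𝓗}) *
        ∫ η, g (openEdgeCluster η x) ∂(prodBernoulli (wW ω)) with hCovO
  set CovV : BondConfig V → ℝ := fun ω =>
    (∫ η in (⋃ t ∈ S, openConn v t), g (openEdgeCluster η x) ∂(prodBernoulli (wW ω))) -
      (prodBernoulli (wW ω)).real (⋃ t ∈ S, openConn v t) * ∫ η, g (openEdgeCluster η x) ∂(prodBernoulli (wW ω)) with hCovV
  set pW : BondConfig V → ℝ := fun ω =>
    (prodBernoulli (wW ω)).real ({η : BondConfig V | ∀ t ∈ S, ¬ (openGraph η).Reachable v t} ∩ pinEv o 𝓗 v) /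
      (prodBernoulli (wW ω)).real {η : BondConfig V | ∀ t ∈ S, ¬ (openGraph η).Reachable v t} with hpW
  set M : ℝ := μ.real {ω : BondConfig V | ∀ a ∈ (↑S ∪ Y : Set V), ¬ (openGraph ω).Reachable v a} with hM
  set E : ℝ := μ.real ({ω : BondConfig V | ∀ a ∈ (↑S ∪ Y : Set V), ¬ (openGraph ω).Reachable v a} ∩ pinEv o 𝓗 v) with hE
  set Dset : Set (BondConfig V) := {ω : BondConfig V | ∀ y ∈ Y, ¬ (openGraph ω).Reachable x y} with hDset
  change E * ∫ ω in Dset, CovV ω ∂μ ≤ M * ∫ ω in Dset, pW ω * CovV ω ∂μ at hHtw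
  change 0 ≤ ∫ ω in Dset, (CovO ω - pObsConst w o 𝓗 v (↑S ∪ Y) * CovV ω) ∂μ
  have hmeas : ∀ T : Set (BondConfig V), MeasurableSet T := fun _ => MeasurableSet.of_discrete
  have hint : ∀ (k : BondConfig V → ℝ) (T : Set (BondConfig V)), IntegrableOn k T μ :=
    fun k T => (Integrable.of_finite).integrableOn
  -- positivity of the global conditioning probability and the observers' constant
  have hMpos : 0 < M := by
    refine prodBernoulli_real_pos_of_nonempty hw ⟨∅, fun a ha hreach => ?_⟩
    have hbot : openGraph (∅ : BondConfig V) = ⊥ := by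
      unfold openGraph; exact SimpleGraph.fromEdgeSet_empty
    rw [hbot, SimpleGraph.reachable_bot] at hreach
    subst hreach
    rcases ha with ha | ha
    · exact hvS (Finset.mem_coe.1 ha)
    · exact hvY ha
  have hobs : pObsConst w o 𝓗 v (↑S ∪ Y) = E / M := by unfold pObsConst; rfl
  -- (K6)_ψ in each world: `pW ω · CovV ω ≤ CovO ω`
  have hworld : ∀ ω : BondConfig V, pW ω * CovV ω ≤ CovO ω := by
    intro ω
    have hK6 := setFourPT_pin (wW ω) (↑S : Set V) o v x (Finset.mem_coe.2 hxS) 𝓗 h𝓗 g hg hg0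
    rw [setOf_forall_not_reachable_comm S v, CSH.setOf_exists_reachable_eq_biUnion S v,
      CSH.setOf_exists_reachable_eq_biUnion S o] at hK6
    -- positivity of the world probability of `{v ↮ S}` (all world weights are `< 1`)
    have hlt : ∀ e, wW ω e < 1 := by
      intro e
      simp only [hwW]
      split_ifs
      · exact zero_lt_one
      · exact (hw e).2
    have hMWpos : 0 < (prodBernoulli (wW ω)).real {η : BondConfig V | ∀ t ∈ S, ¬ (openGraph η).Reachable v t} := by
      refine CSH.prodBernoulli_real_pos_of_empty_mem (wW ω) hlt (fun t ht hreach => ?_)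
      have hbot : openGraph (∅ : BondConfig V) = ⊥ := by
        unfold openGraph; exact SimpleGraph.fromEdgeSet_empty
      rw [hbot, SimpleGraph.reachable_bot] at hreach
      exact hvS (hreach ▸ ht)
    set MW := (prodBernoulli (wW ω)).real {η : BondConfig V | ∀ t ∈ S, ¬ (openGraph η).Reachable v t} with hMW
    set EW := (prodBernoulli (wW ω)).real ({η : BondConfig V | ∀ t ∈ S, ¬ (openGraph η).Reachable v t} ∩ pinEv o 𝓗 v)
      with hEW
    change EW * CovV ω ≤ MW * CovO ω at hK6
    have hp : pW ω = EW / MW := rfl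
    rw [hp, div_mul_eq_mul_div, div_le_iff₀ hMWpos]
    linarith [hK6, mul_comm MW (CovO ω)]
  -- integrate the world inequality over `Dset`
  have hI1 : ∫ ω in Dset, pW ω * CovV ω ∂μ ≤ ∫ ω in Dset, CovO ω ∂μ :=
    setIntegral_mono_on (hint _ _) (hint _ _) (hmeas Dset) fun ω _ => hworld ω
  -- (Htw)_ψ divided by `M`
  have hI2 : E / M * ∫ ω in Dset, CovV ω ∂μ ≤ ∫ ω in Dset, pW ω * CovV ω ∂μ := by
    rw [div_mul_eq_mul_div, div_le_iff₀ hMpos]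
    linarith [hHtw, mul_comm M (∫ ω in Dset, pW ω * CovV ω ∂μ)]
  rw [integral_sub (hint _ _) (hint _ _), integral_const_mul, hobs]
  linarith [hI1, hI2]

/-- **LEMMA H_ψ, UNCONDITIONAL** (memo §2): for non-degenerate weights, a marker set `S ∋ x` (owner and decoys), the label `o` with an upper
family `𝓗`, an observer `v ∉ S`, `v ∉ Y`, and a monotone edge-cluster functional `g ≥ 0`, the pinned H-part of the world-wise unfolding is
nonnegative: `0 ≤ ∫_{x↮Y} [Cov_{w^ω}(g(C_x), 1{o↔S}·1{C_o ∈ 𝓗}) − μ(pinEv o 𝓗 v | v↮S∪Y)·Cov_{w^ω}(g(C_x), 1{v↔S})] dμ_w(ω)`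
(`hpart_nonneg_of_htw_pin` fed with `htw_world_pin`). (transcription of the memo prim-nh-dp-fatminority CSH-PSI-MEMO.md §2 Lemma H_ψ)
[cite: VandenbergHaggstromKahn2005, Thm. 1.1 (pp. 3–5), Thm. 1.4 (p. 7)] [cite: Gladkov2024, Thm. 3.2 (p. 4)] -/
theorem hpart_nonneg_pin (w : Sym2 V → unitInterval) (hw : ∀ e, 0 < w e ∧ w e < 1) (x : V) (Y : Set V) (S : Finset V)
    (hxS : x ∈ S) (o : V) (𝓗 : Set (Set (Sym2 V))) (h𝓗 : IsUpperSet 𝓗) (v : V) (hvS : v ∉ S) (hvY : v ∉ Y)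
    (g : Set (Sym2 V) → ℝ) (hg : Monotone g) (hg0 : ∀ C, 0 ≤ g C) :
    0 ≤ ∫ ω in {ω : BondConfig V | ∀ y ∈ Y, ¬ (openGraph ω).Reachable x y},
      (((∫ η in (⋃ t ∈ S, openConn o t) ∩ {η | openEdgeCluster η o ∈ 𝓗}, g (openEdgeCluster η x)
            ∂(prodBernoulli fun e => if (∃ z ∈ e, ∃ y ∈ Y, (openGraph ω).Reachable y z) then (0 : unitInterval) else w e)) -
          (prodBernoulli fun e => if (∃ z ∈ e, ∃ y ∈ Y, (openGraph ω).Reachable y z) then (0 : unitInterval) else w e).real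
              ((⋃ t ∈ S, openConn o t) ∩ {η | openEdgeCluster η o ∈ 𝓗}) *
            (∫ η, g (openEdgeCluster η x)
              ∂(prodBernoulli fun e => if (∃ z ∈ e, ∃ y ∈ Y, (openGraph ω).Reachable y z) then (0 : unitInterval) else w e))) -
        pObsConst w o 𝓗 v (↑S ∪ Y) *
          ((∫ η in (⋃ t ∈ S, openConn v t), g (openEdgeCluster η x)
              ∂(prodBernoulli fun e => if (∃ z ∈ e, ∃ y ∈ Y, (openGraph ω).Reachable y z) then (0 : unitInterval) else w e)) -
            (prodBernoulli fun e => if (∃ z ∈ e, ∃ y ∈ Y, (openGraph ω).Reachable y z) then (0 : unitInterval) else w e).real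
                (⋃ t ∈ S, openConn v t) *
              (∫ η, g (openEdgeCluster η x)
                ∂(prodBernoulli fun e => if (∃ z ∈ e, ∃ y ∈ Y, (openGraph ω).Reachable y z) then (0 : unitInterval) else w e))))
      ∂(prodBernoulli w) :=
  hpart_nonneg_of_htw_pin w hw x Y S hxS o 𝓗 h𝓗 v hvS hvY g hg hg0 (htw_world_pin w x Y S hxS o 𝓗 h𝓗 v hvS g hg hg0)

end PinCSH

end Summit.CriticalPhenomena.PercolationContinuityZ3.Theorems

end
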